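import Literature.MeasureTheory.Group.ConjClassClosedEmbedding
import Mathlib.Topology.LocallyClosed
import HarnessLib

/-!
# A LOCALLY CLOSED orbit is a homogeneous space: open orbit maps, `G ⧸ G_x ≃ G • x`, and the conjugation dress `G ⧸ C(γ) ≃ 𝒪(γ)`
# for a locally closed conjugacy class (Glimm–Effros; σ-compact groups, Baire category)

Topic `MeasureTheory/Group`; namespace `Literature.MeasureTheory.Group`.  THEOREMS ONLY (no definition, no instance, no notation, no named fact, no `sorry`).
Sequel to ★ `ConjClassClosedEmbedding` (the CLOSED class: closed-embedding orbit map), generalised to LOCALLY CLOSED classes — the case of the UNIPOTENT classes of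
a reductive `p`-adic group (a non-trivial unipotent class is never closed: its closure contains `1`), as met in the Howe ∕ Harish-Chandra finiteness argument for
invariant distributions supported on the unipotent variety ([Rogawski1990, §8.1 p. 113]; cell `pub/hodgecm-mathlib`, crux H413, line LH4, Shalika sub-road organ
‹ORBIT-OPEN› = memo SPAN-b; its hypothesis `IsLocallyClosed 𝒪(u)` for the unipotent classes of `U(3)` is organ ‹U3-STRATA›).

* §1 ONE ORBIT OF A CONTINUOUS ACTION (`G` σ-compact, `X` locally compact Hausdorff, `G • x` locally closed): `G • x` is locally compact (Mathlib
  `IsLocallyClosed.locallyCompactSpace`), hence Baire; the action on it (Mathlib's `MulAction G (orbit G x)`, continuity `continuousSMul_orbit`) is transitive, so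
  Mathlib's open-mapping theorem `isOpenMap_smul_of_sigmaCompact` makes every orbit map `g ↦ g • y : G → G • x` OPEN (`isOpenMap_smul_orbit_of_isLocallyClosed`,
  `isOpenMap_smul_codRestrict_orbit_of_isLocallyClosed`; set form `exists_isOpen_inter_orbit_eq_image_smul_of_isLocallyClosed`, filter form
  `smul_singleton_mem_nhdsWithin_orbit_of_isLocallyClosed`), and `G ⧸ Stab(x) ≃ₜ G • x` (`isHomeomorph_orbitEquivQuotientStabilizer_symm_of_isLocallyClosed`) — the
  implication «orbit locally closed ⇒ `G ⧸ G_x → G·x` homeomorphism» of the Glimm–Effros theorem [Feres1998, Thm. 1.2.2].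
* §2 THE CONJUGATION DRESS (the conjugation action on the class is built locally, as in ★ `isOpenMap_conj_codRestrict_of_isClosed`): for `γ₀` with LOCALLY CLOSED
  class in a σ-compact, locally compact, Hausdorff group, the orbit map `G → 𝒪(γ₀)` is open (`isOpenMap_conj_codRestrict_of_isLocallyClosed`), ★ `descConj γ₀ C(γ₀) _ id`
  is a homeomorphism onto the class (`isHomeomorph_rangeFactorization_descConj_id_of_isLocallyClosed`) and an EMBEDDING (`isEmbedding_descConj_id_of_isLocallyClosed`);
  relative openness of `{u γ u⁻¹ : u ∈ U}` (`exists_isOpen_inter_eq_image_conj_of_isLocallyClosed`, `conj_image_mem_nhdsWithin_of_isLocallyClosed`); `setOf_conj_eq_of_mem`,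
  `isSigmaCompact_conjClass`.
* §3 ORBITAL INTEGRANDS at a locally closed class: `{y C(γ₀) ∣ y γ₀ y⁻¹ ∈ K}` is compact for every compact `K ⊆ 𝒪(γ₀)`
  (`isCompact_preimage_descConj_id_of_isLocallyClosed`); a compactly supported `f` whose support stays away from the BOUNDARY `closure 𝒪(γ₀) ∖ 𝒪(γ₀)` (for a unipotent
  class: away from the smaller unipotent classes) has a compactly supported, hence integrable, orbital integrand (`hasCompactSupport_descConj_of_isLocallyClosed`,
  `integrable_descConj_of_isLocallyClosed`) — the Ranga-Rao clause OFF the boundary strata, for free.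
HONEST LABEL: pure topology, count-neutral, pays no letter by itself; HC_CM is proved only modulo the 7 printed citations (2 remaining: hLiu418 = stmt-HodgeConjecture-24832,
h413 = stmt-HodgeConjecture-24833) until rung 0 closes.

## References
* [Feres1998] R. Feres, *Dynamical Systems and Semisimple Groups: An Introduction*, Cambridge Tracts in Math. 126 (1998): Thm. 1.2.2 (pp. 4–5) — the Glimm–Effros
  theorem (orbits locally closed ⟺ `G ⧸ G_x → G·x` homeomorphism ⟺ tame action).
* [DeitmarEchterhoff2014] A. Deitmar, S. Echterhoff, *Principles of Harmonic Analysis*, 2nd ed. (2014): Thm. 4.2.10 (open mapping theorem for σ-compact groups,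
  pp. 96–97), Prop. A.9.1 (locally compact Hausdorff spaces are Baire, p. 281).
* [Rogawski1990] J. Rogawski, *Automorphic Representations of Unitary Groups in Three Variables* (1990): §8.1 p. 113 (measures on the unipotent classes).
-/

noncomputable section

open MeasureTheory Measure Topology Set Filter MulAction
open scoped Pointwise

namespace Literature.MeasureTheory.Group

/-! ## §1 One locally closed orbit of a continuous action of a σ-compact group -/

section Action

variable {G : Type*} [Group G] [TopologicalSpace G] [IsTopologicalGroup G]
  {X : Type*} [TopologicalSpace X] [MulAction G X] [ContinuousSMul G X]

omit [IsTopologicalGroup G] in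
/-- The action of `G` on ONE orbit `G • x` (Mathlib's `MulAction G (orbit G x)`, `↑(g • y) = g • ↑y`) is continuous when the
action on `X` is. [cite: Feres1998, Thm. 1.2.2 (pp. 4–5)] -/
theorem continuousSMul_orbit (x : X) : ContinuousSMul G (orbit G x) := by
  have h : Continuous fun p : G × orbit G x => p.1 • (p.2 : X) := continuous_fst.smul (continuous_subtype_val.comp continuous_snd)
  exact ⟨h.subtype_mk fun p => (p.1 • p.2).2⟩

/-- **Open orbit maps onto a locally closed orbit (Glimm–Effros).**  `G` σ-compact acting continuously on a locally compact
Hausdorff space `X`: if the orbit `G • x` is LOCALLY CLOSED in `X`, then for every point `y` of the orbit the orbit map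
`g ↦ g • y : G → G • x` is an OPEN map — `G • x` is locally compact Hausdorff in the subspace topology (Mathlib
`IsLocallyClosed.locallyCompactSpace`), hence a Baire space, the action on it is continuous and transitive, and Mathlib's
Baire-category open-mapping theorem `isOpenMap_smul_of_sigmaCompact` applies.
[cite: Feres1998, Thm. 1.2.2 (pp. 4–5)] [cite: DeitmarEchterhoff2014, Thm. 4.2.10 (pp. 96–97); Prop. A.9.1 (p. 281)] -/
theorem isOpenMap_smul_orbit_of_isLocallyClosed [SigmaCompactSpace G] [T2Space X] [LocallyCompactSpace X]
    {x : X} (hO : IsLocallyClosed (orbit G x)) (y : orbit G x) : IsOpenMap fun g : G => g • y := by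
  haveI : ContinuousSMul G (orbit G x) := continuousSMul_orbit x
  haveI : LocallyCompactSpace (orbit G x) := hO.locallyCompactSpace
  exact isOpenMap_smul_of_sigmaCompact (G := G) (X := orbit G x) y

/-- The orbit map `g ↦ g • x`, viewed as a map `G → G • x` onto the locally closed orbit, is open.
[cite: Feres1998, Thm. 1.2.2 (pp. 4–5)] -/
theorem isOpenMap_smul_codRestrict_orbit_of_isLocallyClosed [SigmaCompactSpace G] [T2Space X] [LocallyCompactSpace X]
    {x : X} (hO : IsLocallyClosed (orbit G x)) :
    IsOpenMap fun g : G => (⟨g • x, mem_orbit x g⟩ : orbit G x) := by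
  have hfun : (fun g : G => (⟨g • x, mem_orbit x g⟩ : orbit G x)) = fun g : G => g • (⟨x, mem_orbit_self x⟩ : orbit G x) :=
    funext fun g => Subtype.ext rfl
  rw [hfun]; exact isOpenMap_smul_orbit_of_isLocallyClosed hO _

/-- **Set form.**  For `U ⊆ G` open and a locally closed orbit `G • x`, the set `{g • x : g ∈ U}` is RELATIVELY OPEN in the
orbit: `V ∩ G • x = {g • x : g ∈ U}` for some open `V ⊆ X`. [cite: Feres1998, Thm. 1.2.2 (pp. 4–5)] -/
theorem exists_isOpen_inter_orbit_eq_image_smul_of_isLocallyClosed [SigmaCompactSpace G] [T2Space X] [LocallyCompactSpace X]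
    {x : X} (hO : IsLocallyClosed (orbit G x)) {U : Set G} (hU : IsOpen U) :
    ∃ V : Set X, IsOpen V ∧ V ∩ orbit G x = (fun g : G => g • x) '' U := by
  obtain ⟨V, hV, hVU⟩ := isOpen_induced_iff.1 (isOpenMap_smul_codRestrict_orbit_of_isLocallyClosed hO U hU)
  refine ⟨V, hV, Set.ext fun z => ⟨?_, ?_⟩⟩
  · rintro ⟨hzV, hzO⟩
    have hz : (⟨z, hzO⟩ : orbit G x) ∈ Subtype.val ⁻¹' V := hzV
    rw [hVU] at hz; obtain ⟨g, hg, hgz⟩ := hz; exact ⟨g, hg, congrArg Subtype.val hgz⟩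
  · rintro ⟨g, hg, rfl⟩
    refine ⟨?_, mem_orbit x g⟩
    have hz : (⟨g • x, mem_orbit x g⟩ : orbit G x) ∈ (fun g : G => (⟨g • x, mem_orbit x g⟩ : orbit G x)) '' U :=
      ⟨g, hg, rfl⟩
    rw [← hVU] at hz; exact hz

/-- **Filter form.**  For `U ∈ 𝓝 (1 : G)` and `y` on a locally closed orbit `G • x`: `U • {y}` is a neighbourhood of `y`
WITHIN the orbit. [cite: Feres1998, Thm. 1.2.2 (pp. 4–5)] -/
theorem smul_singleton_mem_nhdsWithin_orbit_of_isLocallyClosed [SigmaCompactSpace G] [T2Space X] [LocallyCompactSpace X]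
    {x : X} (hO : IsLocallyClosed (orbit G x)) {U : Set G} (hU : U ∈ 𝓝 (1 : G)) {y : X} (hy : y ∈ orbit G x) :
    U • ({y} : Set X) ∈ 𝓝[orbit G x] y := by
  haveI : ContinuousSMul G (orbit G x) := continuousSMul_orbit x
  haveI : LocallyCompactSpace (orbit G x) := hO.locallyCompactSpace
  have h : U • ({(⟨y, hy⟩ : orbit G x)} : Set (orbit G x)) ∈ 𝓝 (⟨y, hy⟩ : orbit G x) :=
    smul_singleton_mem_nhds_of_sigmaCompact (X := orbit G x) hU ⟨y, hy⟩
  have h' : Subtype.val '' (U • ({(⟨y, hy⟩ : orbit G x)} : Set (orbit G x))) ∈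
      map (Subtype.val : orbit G x → X) (𝓝 (⟨y, hy⟩ : orbit G x)) :=
    image_mem_map h
  rw [map_nhds_subtype_val] at h'
  have heq : Subtype.val '' (U • ({(⟨y, hy⟩ : orbit G x)} : Set (orbit G x))) = U • ({y} : Set X) := by
    rw [Set.smul_singleton, Set.smul_singleton, Set.image_image]
    rfl
  rw [heq] at h'
  exact h'

/-- **`G ⧸ Stab(x) ≃ₜ G • x` for a locally closed orbit (Glimm–Effros).**  Mathlib's bijection
`(orbitEquivQuotientStabilizer G x).symm : G ⧸ Stab(x) → G • x`, `g Stab(x) ↦ g • x`, is a HOMEOMORPHISM when `G` is σ-compact,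
`X` is locally compact Hausdorff and the orbit is locally closed: it is continuous (lift of the continuous orbit map through the
quotient map) and open (`isOpenMap_smul_codRestrict_orbit_of_isLocallyClosed`, the quotient map being surjective).
[cite: Feres1998, Thm. 1.2.2 (pp. 4–5)] -/
theorem isHomeomorph_orbitEquivQuotientStabilizer_symm_of_isLocallyClosed [SigmaCompactSpace G] [T2Space X]
    [LocallyCompactSpace X] {x : X} (hO : IsLocallyClosed (orbit G x)) :
    IsHomeomorph ((orbitEquivQuotientStabilizer G x).symm : G ⧸ stabilizer G x → orbit G x) := by
  set e := (orbitEquivQuotientStabilizer G x).symm with he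
  have hcomp : (e : G ⧸ stabilizer G x → orbit G x) ∘ (QuotientGroup.mk : G → G ⧸ stabilizer G x) =
      fun g : G => (⟨g • x, mem_orbit x g⟩ : orbit G x) := by
    funext g
    exact Subtype.ext (orbitEquivQuotientStabilizer_symm_apply G x g)
  have hc : Continuous fun g : G => (⟨g • x, mem_orbit x g⟩ : orbit G x) :=
    (continuous_id.smul continuous_const).subtype_mk _
  refine ⟨?_, ?_, e.bijective⟩
  · rw [QuotientGroup.isOpenQuotientMap_mk.isQuotientMap.continuous_iff, hcomp]
    exact hc
  · intro U hU
    have himage : (e : G ⧸ stabilizer G x → orbit G x) '' U =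
        (fun g : G => (⟨g • x, mem_orbit x g⟩ : orbit G x)) ''
          ((QuotientGroup.mk : G → G ⧸ stabilizer G x) ⁻¹' U) := by
      rw [← hcomp, Set.image_comp, Set.image_preimage_eq U QuotientGroup.mk_surjective]
    rw [himage]
    exact isOpenMap_smul_codRestrict_orbit_of_isLocallyClosed hO _ (hU.preimage QuotientGroup.continuous_mk)

end Action

/-! ## §2 The conjugation dress: a locally closed conjugacy class -/

section Conj

variable {G : Type*} [Group G] (γ₀ : G)

/-- Base change along a class: if `γ` is conjugate to `γ₀` then `𝒪(γ) = 𝒪(γ₀)`. [cite: Feres1998, Thm. 1.2.2 (pp. 4–5)] -/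
theorem setOf_conj_eq_of_mem {γ : G} (hγ : γ ∈ {g | ∃ y : G, y * γ₀ * y⁻¹ = g}) :
    {g | ∃ y : G, y * γ * y⁻¹ = g} = {g | ∃ y : G, y * γ₀ * y⁻¹ = g} := by
  obtain ⟨a, rfl⟩ := hγ
  ext g
  constructor
  · rintro ⟨y, rfl⟩
    exact ⟨y * a, by simp only [mul_inv_rev, mul_assoc]⟩
  · rintro ⟨y, rfl⟩
    refine ⟨y * a⁻¹, ?_⟩
    simp only [mul_inv_rev, inv_inv, mul_assoc, inv_mul_cancel_left]

variable [TopologicalSpace G] [IsTopologicalGroup G]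

/-- Every conjugacy class of a σ-compact group is σ-compact (continuous image of `G`). [cite: Feres1998, Thm. 1.2.2 (pp. 4–5)] -/
theorem isSigmaCompact_conjClass [SigmaCompactSpace G] : IsSigmaCompact {g | ∃ y : G, y * γ₀ * y⁻¹ = g} := by
  have h : {g | ∃ y : G, y * γ₀ * y⁻¹ = g} = (fun y : G => y * γ₀ * y⁻¹) '' Set.univ := by
    ext g
    simp only [Set.mem_setOf_eq, Set.image_univ, Set.mem_range]
  rw [h]
  exact isSigmaCompact_univ.image ((continuous_id.mul continuous_const).mul continuous_id.inv)

/-- **Open orbit map onto a LOCALLY CLOSED conjugacy class.**  In a σ-compact, locally compact, Hausdorff topological group, if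
the conjugacy class `𝒪(γ₀) = {y γ₀ y⁻¹}` is locally closed (open in its closure), then `y ↦ y γ₀ y⁻¹`, viewed as a map
`G → 𝒪(γ₀)`, is OPEN: the conjugation action of `G` on `𝒪(γ₀)` is continuous and transitive, `𝒪(γ₀)` is locally compact
Hausdorff (Mathlib `IsLocallyClosed.locallyCompactSpace`), hence Baire, and Mathlib's open-mapping theorem
`isOpenMap_smul_of_sigmaCompact` applies (★ `isOpenMap_conj_codRestrict_of_isClosed` is the closed case).
[cite: Feres1998, Thm. 1.2.2 (pp. 4–5)] [cite: DeitmarEchterhoff2014, Thm. 4.2.10 (pp. 96–97); Prop. A.9.1 (p. 281)] -/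
theorem isOpenMap_conj_codRestrict_of_isLocallyClosed [SigmaCompactSpace G] [LocallyCompactSpace G] [T2Space G]
    (hO : IsLocallyClosed (Set.range fun y : G => y * γ₀ * y⁻¹)) :
    IsOpenMap (Set.rangeFactorization fun y : G => y * γ₀ * y⁻¹) := by
  set O : Set G := Set.range fun y : G => y * γ₀ * y⁻¹ with hOdef
  have hmem : ∀ (g : G) (x : O), g * (x : G) * g⁻¹ ∈ O := by
    rintro g ⟨_, y, rfl⟩
    exact ⟨g * y, by simp only [mul_inv_rev, mul_assoc]⟩
  letI : MulAction G O :=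
    { smul := fun g x => ⟨g * (x : G) * g⁻¹, hmem g x⟩
      one_smul := fun x => Subtype.ext (by
        change (1 : G) * (x : G) * (1 : G)⁻¹ = x
        simp)
      mul_smul := fun g h x => Subtype.ext (by
        change g * h * (x : G) * (g * h)⁻¹ = g * (h * (x : G) * h⁻¹) * g⁻¹
        simp only [mul_inv_rev, mul_assoc]) }
  have hsmul : ∀ (g : G) (x : O), ((g • x : O) : G) = g * (x : G) * g⁻¹ := fun _ _ => rfl
  haveI : ContinuousSMul G O :=
    ⟨(((continuous_fst.mul (continuous_subtype_val.comp continuous_snd)).mul continuous_fst.inv).subtype_mk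
        fun p : G × O => hmem p.1 p.2).congr fun _ => rfl⟩
  haveI : MulAction.IsPretransitive G O :=
    ⟨by
      rintro ⟨_, a, rfl⟩ ⟨_, b, rfl⟩
      refine ⟨b * a⁻¹, Subtype.ext ?_⟩
      rw [hsmul]
      simp only [mul_inv_rev, inv_inv, mul_assoc, inv_mul_cancel_left]⟩
  haveI : LocallyCompactSpace O := hO.locallyCompactSpace
  have x₀mem : γ₀ ∈ O := ⟨1, by simp⟩
  have hfun : (Set.rangeFactorization fun y : G => y * γ₀ * y⁻¹) = fun g : G => g • (⟨γ₀, x₀mem⟩ : O) := by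
    funext g
    exact Subtype.ext rfl
  rw [hfun]
  exact isOpenMap_smul_of_sigmaCompact (G := G) (X := O) ⟨γ₀, x₀mem⟩

/-- **The orbit map on `G ⧸ C(γ₀)` is a homeomorphism onto a locally closed class.**  In a σ-compact, locally compact,
Hausdorff group, if `𝒪(γ₀)` is locally closed then `y C(γ₀) ↦ y γ₀ y⁻¹` (★ `descConj γ₀ C(γ₀) _ id`), co-restricted to its
range `𝒪(γ₀)` (★ `range_descConj_id`), is a homeomorphism `G ⧸ C(γ₀) ≃ 𝒪(γ₀)`: a continuous bijection (★
`injective_descConj_id_centralizer`), open onto the class by `isOpenMap_conj_codRestrict_of_isLocallyClosed`.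
[cite: Feres1998, Thm. 1.2.2 (pp. 4–5)] -/
theorem isHomeomorph_rangeFactorization_descConj_id_of_isLocallyClosed [SigmaCompactSpace G] [LocallyCompactSpace G]
    [T2Space G] (hO : IsLocallyClosed {g | ∃ y : G, y * γ₀ * y⁻¹ = g}) :
    IsHomeomorph (Set.rangeFactorization (descConj γ₀ (Subgroup.centralizer ({γ₀} : Set G))
      (fun _ hg => Subgroup.mem_centralizer_singleton_iff.1 hg) id)) := by
  set φ := descConj γ₀ (Subgroup.centralizer ({γ₀} : Set G))
    (fun _ hg => Subgroup.mem_centralizer_singleton_iff.1 hg) id with hφ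
  have hrange : Set.range φ = Set.range fun y : G => y * γ₀ * y⁻¹ := range_descConj_id γ₀ _ _
  have hO' : IsLocallyClosed (Set.range fun y : G => y * γ₀ * y⁻¹) := hO
  have hOφ : IsLocallyClosed (Set.range φ) := hrange ▸ hO'
  set ψ : G ⧸ Subgroup.centralizer ({γ₀} : Set G) → Set.range φ := Set.rangeFactorization φ with hψ
  have hψc : Continuous ψ := (continuous_descConj_id γ₀ _ _).subtype_mk _
  have hψi : Function.Injective ψ := fun a b hab =>
    injective_descConj_id_centralizer γ₀ (congrArg Subtype.val hab)
  have hψs : Function.Surjective ψ := by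
    rintro ⟨_, q, rfl⟩
    exact ⟨q, rfl⟩
  -- openness: transport `isOpenMap_conj_codRestrict_of_isLocallyClosed` along `Set.range φ = 𝒪(γ₀)`
  have hψmk : ∀ y : G, ((ψ (QuotientGroup.mk y) : Set.range φ) : G) = y * γ₀ * y⁻¹ := fun y => rfl
  have hψo : IsOpenMap ψ := by
    intro U hU
    have hopen := isOpenMap_conj_codRestrict_of_isLocallyClosed γ₀ hO'
      ((QuotientGroup.mk : G → G ⧸ Subgroup.centralizer ({γ₀} : Set G)) ⁻¹' U) (hU.preimage QuotientGroup.continuous_mk)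
    obtain ⟨V, hV, hVU⟩ := isOpen_induced_iff.1 hopen
    refine isOpen_induced_iff.2 ⟨V, hV, Set.ext fun z => ⟨fun hz => ?_, ?_⟩⟩
    · -- `z ∈ V`: write `z = ψ q`, `q = mk y`
      obtain ⟨q, rfl⟩ := hψs z
      induction q using QuotientGroup.induction_on with
      | H y =>
        have hy : (⟨y * γ₀ * y⁻¹, ⟨y, rfl⟩⟩ : Set.range fun y : G => y * γ₀ * y⁻¹) ∈ Subtype.val ⁻¹' V := hz
        rw [hVU] at hy
        obtain ⟨y', hy'U, hy'⟩ := hy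
        refine ⟨QuotientGroup.mk y', hy'U, Subtype.ext ?_⟩
        have := congrArg Subtype.val hy'
        exact this
    · rintro ⟨q, hqU, rfl⟩
      induction q using QuotientGroup.induction_on with
      | H y =>
        have hy : (⟨y * γ₀ * y⁻¹, ⟨y, rfl⟩⟩ : Set.range fun y : G => y * γ₀ * y⁻¹) ∈
            (Set.rangeFactorization fun y : G => y * γ₀ * y⁻¹) ''
              ((QuotientGroup.mk : G → G ⧸ Subgroup.centralizer ({γ₀} : Set G)) ⁻¹' U) := ⟨y, hqU, rfl⟩
        rw [← hVU] at hy
        exact hy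
  exact ⟨hψc, hψo, hψi, hψs⟩

/-- **A locally closed conjugacy class has an EMBEDDING orbit map** `G ⧸ C(γ₀) → G` (a homeomorphism onto the class followed
by the inclusion of the locally closed class; ★ `isClosedEmbedding_descConj_id_of_isClosed` is the closed case).
[cite: Feres1998, Thm. 1.2.2 (pp. 4–5)] -/
theorem isEmbedding_descConj_id_of_isLocallyClosed [SigmaCompactSpace G] [LocallyCompactSpace G] [T2Space G]
    (hO : IsLocallyClosed {g | ∃ y : G, y * γ₀ * y⁻¹ = g}) :
    IsEmbedding (descConj γ₀ (Subgroup.centralizer ({γ₀} : Set G))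
      (fun _ hg => Subgroup.mem_centralizer_singleton_iff.1 hg) id) := by
  have h := isHomeomorph_rangeFactorization_descConj_id_of_isLocallyClosed γ₀ hO
  have hcomp : descConj γ₀ (Subgroup.centralizer ({γ₀} : Set G)) (fun _ hg => Subgroup.mem_centralizer_singleton_iff.1 hg) id =
      Subtype.val ∘ Set.rangeFactorization (descConj γ₀ (Subgroup.centralizer ({γ₀} : Set G))
        (fun _ hg => Subgroup.mem_centralizer_singleton_iff.1 hg) id) := rfl
  rw [hcomp]
  exact IsEmbedding.subtypeVal.comp (IsHomeomorph.homeomorph _ h).isEmbedding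

/-- **Set form.**  For `U ⊆ G` open and a locally closed class `𝒪(γ₀)`: `{u γ₀ u⁻¹ : u ∈ U} = V ∩ 𝒪(γ₀)` for some open `V ⊆ G`
(relative openness of the `U`-sweep of `γ₀`; move the base point along the class with `setOf_conj_eq_of_mem`).
[cite: Feres1998, Thm. 1.2.2 (pp. 4–5)] -/
theorem exists_isOpen_inter_eq_image_conj_of_isLocallyClosed [SigmaCompactSpace G] [LocallyCompactSpace G] [T2Space G]
    (hO : IsLocallyClosed {g | ∃ y : G, y * γ₀ * y⁻¹ = g}) {U : Set G} (hU : IsOpen U) :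
    ∃ V : Set G, IsOpen V ∧ V ∩ {g | ∃ y : G, y * γ₀ * y⁻¹ = g} = (fun y : G => y * γ₀ * y⁻¹) '' U := by
  have hO' : IsLocallyClosed (Set.range fun y : G => y * γ₀ * y⁻¹) := hO
  obtain ⟨V, hV, hVU⟩ := isOpen_induced_iff.1 (isOpenMap_conj_codRestrict_of_isLocallyClosed γ₀ hO' U hU)
  refine ⟨V, hV, Set.ext fun z => ⟨?_, ?_⟩⟩
  · rintro ⟨hzV, hzO⟩
    have hz : (⟨z, hzO⟩ : Set.range fun y : G => y * γ₀ * y⁻¹) ∈ Subtype.val ⁻¹' V := hzV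
    rw [hVU] at hz; obtain ⟨g, hg, hgz⟩ := hz; exact ⟨g, hg, congrArg Subtype.val hgz⟩
  · rintro ⟨g, hg, rfl⟩
    refine ⟨?_, ⟨g, rfl⟩⟩
    have hz : (⟨g * γ₀ * g⁻¹, ⟨g, rfl⟩⟩ : Set.range fun y : G => y * γ₀ * y⁻¹) ∈
        (Set.rangeFactorization fun y : G => y * γ₀ * y⁻¹) '' U := ⟨g, hg, rfl⟩
    rw [← hVU] at hz; exact hz

/-- **Filter form.**  For `U ∈ 𝓝 (1 : G)` and `γ` on a locally closed class `𝒪(γ₀)`: the `U`-sweep `{u γ u⁻¹ : u ∈ U}` is a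
neighbourhood of `γ` WITHIN the class. [cite: Feres1998, Thm. 1.2.2 (pp. 4–5)] -/
theorem conj_image_mem_nhdsWithin_of_isLocallyClosed [SigmaCompactSpace G] [LocallyCompactSpace G] [T2Space G]
    (hO : IsLocallyClosed {g | ∃ y : G, y * γ₀ * y⁻¹ = g}) {U : Set G} (hU : U ∈ 𝓝 (1 : G)) {γ : G}
    (hγ : γ ∈ {g | ∃ y : G, y * γ₀ * y⁻¹ = g}) :
    (fun u : G => u * γ * u⁻¹) '' U ∈ 𝓝[{g | ∃ y : G, y * γ₀ * y⁻¹ = g}] γ := by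
  -- move the base point to `γ`
  have hOγ : IsLocallyClosed {g | ∃ y : G, y * γ * y⁻¹ = g} := by rwa [setOf_conj_eq_of_mem γ₀ hγ]
  rw [← setOf_conj_eq_of_mem γ₀ hγ]
  obtain ⟨W, hWU, hWo, hW1⟩ := mem_nhds_iff.1 hU
  obtain ⟨V, hV, hVW⟩ := exists_isOpen_inter_eq_image_conj_of_isLocallyClosed γ hOγ hWo
  have hγV : γ ∈ V := by
    have : γ ∈ V ∩ {g | ∃ y : G, y * γ * y⁻¹ = g} := by
      rw [hVW]
      exact ⟨1, hW1, by simp⟩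
    exact this.1
  refine mem_of_superset (inter_mem_nhdsWithin _ (hV.mem_nhds hγV)) ?_
  intro z hz
  have hz' : z ∈ V ∩ {g | ∃ y : G, y * γ * y⁻¹ = g} := ⟨hz.2, hz.1⟩
  rw [hVW] at hz'
  exact Set.image_mono hWU hz'

/-! ## §3 Consequences for orbital integrands at a locally closed class -/

/-- **Compact pieces of a locally closed class have compact preimage in `G ⧸ C(γ₀)`**: for every compact `K ⊆ 𝒪(γ₀)` the set
`{y C(γ₀) ∣ y γ₀ y⁻¹ ∈ K}` is compact (`K` is compact in the subspace `𝒪(γ₀)`, and `G ⧸ C(γ₀) ≃ₜ 𝒪(γ₀)`).  For a CLOSED class the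
hypothesis `K ⊆ 𝒪(γ₀)` is not needed (★ `isCompact_preimage_descConj_id_of_isClosed`).
[cite: Feres1998, Thm. 1.2.2 (pp. 4–5)] [cite: Rogawski1990, §8.1 p. 113] -/
theorem isCompact_preimage_descConj_id_of_isLocallyClosed [SigmaCompactSpace G] [LocallyCompactSpace G] [T2Space G]
    (hO : IsLocallyClosed {g | ∃ y : G, y * γ₀ * y⁻¹ = g}) {K : Set G} (hK : IsCompact K)
    (hKO : K ⊆ {g | ∃ y : G, y * γ₀ * y⁻¹ = g}) :
    IsCompact (descConj γ₀ (Subgroup.centralizer ({γ₀} : Set G))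
      (fun _ hg => Subgroup.mem_centralizer_singleton_iff.1 hg) id ⁻¹' K) := by
  set φ := descConj γ₀ (Subgroup.centralizer ({γ₀} : Set G))
    (fun _ hg => Subgroup.mem_centralizer_singleton_iff.1 hg) id with hφ
  have h := isHomeomorph_rangeFactorization_descConj_id_of_isLocallyClosed γ₀ hO
  let e : G ⧸ Subgroup.centralizer ({γ₀} : Set G) ≃ₜ Set.range φ := IsHomeomorph.homeomorph _ h
  have hrange : Set.range φ = {g | ∃ y : G, y * γ₀ * y⁻¹ = g} := range_descConj_id γ₀ _ _
  have hKr : K ⊆ Set.range φ := hrange ▸ hKO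
  -- `K` is compact in the subspace `Set.range φ`
  have hK' : IsCompact (Subtype.val ⁻¹' K : Set (Set.range φ)) := by
    rw [Subtype.isCompact_iff, Set.image_preimage_eq_inter_range, Subtype.range_coe, Set.inter_eq_left.2 hKr]
    exact hK
  have hpre : φ ⁻¹' K = e ⁻¹' (Subtype.val ⁻¹' K) := rfl
  rw [hpre]
  exact e.isCompact_preimage.2 hK'

omit [IsTopologicalGroup G] in
/-- The preimage of any set under the orbit map only sees its trace on the class: `φ ⁻¹' S = φ ⁻¹' (S ∩ closure 𝒪(γ₀))`.
[cite: Feres1998, Thm. 1.2.2 (pp. 4–5)] -/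
theorem preimage_descConj_id_eq_preimage_inter_closure (S : Set G) :
    descConj γ₀ (Subgroup.centralizer ({γ₀} : Set G)) (fun _ hg => Subgroup.mem_centralizer_singleton_iff.1 hg) id ⁻¹' S =
      descConj γ₀ (Subgroup.centralizer ({γ₀} : Set G)) (fun _ hg => Subgroup.mem_centralizer_singleton_iff.1 hg) id ⁻¹'
        (S ∩ closure {g | ∃ y : G, y * γ₀ * y⁻¹ = g}) := by
  ext q
  simp only [Set.mem_preimage, Set.mem_inter_iff, iff_self_and]
  intro _
  apply subset_closure
  rw [← range_descConj_id γ₀ (Subgroup.centralizer ({γ₀} : Set G)) (fun _ hg => Subgroup.mem_centralizer_singleton_iff.1 hg)]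
  exact Set.mem_range_self q

/-- **Compact support of the orbital integrand OFF THE BOUNDARY.**  At a locally closed class `𝒪(γ₀)` of a σ-compact locally
compact Hausdorff group: if `f` has compact support and its topological support meets `closure 𝒪(γ₀)` only inside `𝒪(γ₀)`
(i.e. stays away from the boundary `closure 𝒪(γ₀) ∖ 𝒪(γ₀)` — for a unipotent class: away from the smaller unipotent classes),
then the orbital integrand `y C(γ₀) ↦ f(y γ₀ y⁻¹)` (★ `descConj γ₀ C(γ₀) _ f`) has compact support.  (For a closed class the
boundary is empty: ★ `hasCompactSupport_descConj_of_isClosed`.) [cite: Rogawski1990, §8.1 p. 113] [cite: Feres1998, Thm. 1.2.2 (pp. 4–5)] -/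
theorem hasCompactSupport_descConj_of_isLocallyClosed [SigmaCompactSpace G] [LocallyCompactSpace G] [T2Space G]
    (hO : IsLocallyClosed {g | ∃ y : G, y * γ₀ * y⁻¹ = g}) {α : Type*} [TopologicalSpace α] [Zero α] {f : G → α}
    (hf : HasCompactSupport f)
    (hb : tsupport f ∩ closure {g | ∃ y : G, y * γ₀ * y⁻¹ = g} ⊆ {g | ∃ y : G, y * γ₀ * y⁻¹ = g}) :
    HasCompactSupport (descConj γ₀ (Subgroup.centralizer ({γ₀} : Set G))
      (fun _ hg => Subgroup.mem_centralizer_singleton_iff.1 hg) f) := by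
  set φ := descConj γ₀ (Subgroup.centralizer ({γ₀} : Set G))
    (fun _ hg => Subgroup.mem_centralizer_singleton_iff.1 hg) id with hφ
  -- the compact, closed set `φ ⁻¹' (tsupport f ∩ closure 𝒪)` carries the support of the orbital integrand
  have hKc : IsCompact (tsupport f ∩ closure {g | ∃ y : G, y * γ₀ * y⁻¹ = g}) :=
    hf.inter_right isClosed_closure
  have hpre : IsCompact (φ ⁻¹' (tsupport f ∩ closure {g | ∃ y : G, y * γ₀ * y⁻¹ = g})) :=
    isCompact_preimage_descConj_id_of_isLocallyClosed γ₀ hO hKc hb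
  have hcl : IsClosed (φ ⁻¹' (tsupport f ∩ closure {g | ∃ y : G, y * γ₀ * y⁻¹ = g})) :=
    ((isClosed_tsupport f).inter isClosed_closure).preimage (continuous_descConj_id γ₀ _ _)
  refine HasCompactSupport.intro' hpre hcl fun q hq => ?_
  -- off that set the integrand vanishes: `φ q ∉ tsupport f`
  rw [← preimage_descConj_id_eq_preimage_inter_closure γ₀ (tsupport f)] at hq
  have hq' : φ q ∉ tsupport f := fun h => hq (Set.mem_preimage.2 h)
  rw [descConj_eq_comp]
  exact image_eq_zero_of_notMem_tsupport (f := f) hq'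

/-- **Orbital integrands off the boundary are integrable** against EVERY measure on `G ⧸ C(γ₀)` finite on compacta, for `f`
continuous with compact support staying away from `closure 𝒪(γ₀) ∖ 𝒪(γ₀)` — the trivial half of the convergence of orbital
integrals on a locally closed (e.g. unipotent) class, used stratum by stratum. [cite: Rogawski1990, §8.1 p. 113] -/
theorem integrable_descConj_of_isLocallyClosed [SigmaCompactSpace G] [LocallyCompactSpace G] [T2Space G]
    (hO : IsLocallyClosed {g | ∃ y : G, y * γ₀ * y⁻¹ = g}) {E : Type*} [NormedAddCommGroup E]
    [MeasurableSpace (G ⧸ Subgroup.centralizer ({γ₀} : Set G))] [BorelSpace (G ⧸ Subgroup.centralizer ({γ₀} : Set G))]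
    {f : G → E} (hfc : Continuous f) (hf : HasCompactSupport f)
    (hb : tsupport f ∩ closure {g | ∃ y : G, y * γ₀ * y⁻¹ = g} ⊆ {g | ∃ y : G, y * γ₀ * y⁻¹ = g})
    (m : Measure (G ⧸ Subgroup.centralizer ({γ₀} : Set G))) [IsFiniteMeasureOnCompacts m] :
    Integrable (descConj γ₀ (Subgroup.centralizer ({γ₀} : Set G))
      (fun _ hg => Subgroup.mem_centralizer_singleton_iff.1 hg) f) m :=
  (continuous_descConj γ₀ _ _ hfc).integrable_of_hasCompactSupport
    (hasCompactSupport_descConj_of_isLocallyClosed γ₀ hO hf hb)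

end Conj

end Literature.MeasureTheory.Group
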